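import Summits.QuantumFields.BalabanUV.Beta.EriceFlowEnclosureB12AsPrintedHistoryJumpEnd

/-!
# Beta / EriceFlowEnclosureB12AsPrintedHistoryJumpFirstSentence — the continuity letter of Theorem 2 on the as-printed interface of [I],
# part 5: the history-jump witness defeats already the FIRST SENTENCE of Theorem 2 (the tuned bare coupling «g₀ = g₀(ε, g)» with the run in
# ]0, γ] and g_K = g — the shape of the cell's binder `DagBinding.EndpointExistence` and of prover 2's `…B12AsPrintedLowerEnd.endpoint_of_sign`),
# not merely the logarithmic running (0.31) (β-flow team, prover 1, unit `b2b-balaban-beta-bflow-p1`, gen 33; ROW AP-I·C; PARTS 1–3 =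
# `…B12AsPrintedHistoryJump ∕ …Runs ∕ …End`)

HONEST FRAMING (page 1 of everything the β sub-cell writes): discharging `BetaPertH` makes Bałaban's UV stability UNCONDITIONAL — a
real constructive-QFT result; it is NOT the continuum limit and NOT the Clay problem.  HONEST DEPENDENCY (cell reorg 2026-08-19,
verbatim): «continuum YM on T⁴ ⇐ BetaPertH ∧ nine spine estimates (0/9 proved); BetaPertH ⇐ (D1) ∧ (D4) ∧ CAP+tail; G-an2-4 gates
asym, D1 and NE2/3/4.»  THIS MODULE DISCHARGES NOTHING: [folklore] bookkeeping on PART 2's depth-2 read-out and PART 3's toy setting of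
`B12BetaAsPrinted` ([Balaban1987RG1] as typed, p537882 ✓ ∕ v1.1 p539116 ✓ ∕ v1.2 p554787 ✓).  The toy is OURS; nothing of Bałaban's objects is
asserted; (C) remains the cell's located HYPOTHESIS for the construction.

THE POINT.  PART 2's `not_theorem2Statement_of_gap` refutes `Theorem2Statement` through its first two conjuncts only (run in the interval,
g_K = g); this file says so in the two shapes the cell uses for Theorem 2's FIRST SENTENCE: (a) prover 2's per-(γ, g, K) shape of
`…LowerEnd.endpoint_of_sign` («for every γ ≤ γ₀, every g ≤ γ and every K some bare coupling gives a run in ]0, γ] ending at g») and (b) the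
quantifier shape of `DagBinding.EndpointExistence` ∕ `…LowerEnd.endpoint_of_partialSums` (∃ γ₂ ∀ γ ≤ γ₂ ∃ g⋆ ∀ g ≤ g⋆ ∀ K ∃ g₀), read on the
as-printed carrier's coupling table.  Both FAIL for the history-jump toy, which carries (besides the whole as-printed interface with the p. 266
flag) the SIGN letter `BetaLowerH 0`, the upper letter and every last-variable letter; hence prover 2's `endpoint_of_sign` ∕ `endpoint_of_partialSums`
with their binder (C) dropped are FALSE statements too (`histCont_loadBearing_firstSentence`): on this carrier, continuity of β_{k+1} in the
PRECEDING couplings is a located input of the tuned bare coupling's EXISTENCE, not only of (0.31).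

WHAT THIS FILE PROVES (0 sorry, 0 def):
§16 `not_endpointAt_of_gap` ((a) fails: for every γ > 0 and every bound there are g ≤ min(γ, bound) and K = 2 with NO bare coupling),
    `not_endpointShape_of_gap` ((b) fails under `hcpl` + `hgap`), **`asPrinted_sign_not_firstSentence`** (∃ S hH: Definitions ∧ Conclusions ∧ altCutoff266 ∧ BetaLowerH 0 ∧ BetaUpperH
    ∧ BetaSmoothInLast264 ∧ LastVarLipschitz ∧ ¬(a) ∧ ¬(b)), **`histCont_loadBearing_firstSentence`** (prover 2's `endpoint_of_sign` minus `hcont`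
    and the `EndpointExistence`-shaped `endpoint_of_partialSums` minus `hcont` — with `BetaPartialSumsLowerH 0` from the sign — are FALSE, even with
    `StandingHypotheses ∧ Conclusions` added).
NOT CLAIMED: anything about Bałaban's β or `DagBinding.EndpointExistence` for the construction; continuum; Clay.
-/

namespace Summit.QuantumFields.BalabanUV.Beta.EriceFlowEnclosureB12AsPrintedHistoryJumpFirstSentence

open Literature.MathematicalPhysics.QuantumFieldTheory.Balaban1983to89
open Literature.MathematicalPhysics.QuantumFieldTheory.Balaban1983to89.B12BetaAsPrinted
open Literature.MathematicalPhysics.QuantumFieldTheory.Balaban1983to89.FlowStep (prefixOf Box mem_box BetaContH BetaLowerH BetaUpperH)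
open Literature.MathematicalPhysics.QuantumFieldTheory.Balaban1983to89.FlowStepRuns (BetaPartialSumsLowerH betaPartialSumsLowerH_of_sign)
open Literature.MathematicalPhysics.QuantumFieldTheory.Balaban1983to89.BetaDerivClause (LastVarLipschitz)
open Literature.MathematicalPhysics.QuantumFieldTheory.Balaban1983to89.B12CouplingClausesHistory (BetaSmoothInLast264)
open Summit.QuantumFields.BalabanUV.Beta.EriceFlowEnclosureB12AsPrintedHistoryJump
open Summit.QuantumFields.BalabanUV.Beta.EriceFlowEnclosureB12AsPrintedHistoryJumpRuns
open Summit.QuantumFields.BalabanUV.Beta.EriceFlowEnclosureB12AsPrintedHistoryJumpEnd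

noncomputable section

variable {S : Setting} {b : ℝ} {J : ℝ → ℝ}

/-! ## §16 The first sentence of Theorem 2 fails for the history-jump toy -/

/-- **THE PER-(γ, g, K) SHAPE FAILS**: if the coupling table solves (0.20) forward with the history-jump family (b > 0) and the depth-2 read-out
misses arbitrarily large values, then for EVERY γ > 0 and every bound g_max > 0 there are g ∈ ]0, min(γ, g_max)] and K (= 2) such that NO bare
coupling gives a run in ]0, γ] with g_K = g — the negation of prover 2's `…LowerEnd.endpoint_of_sign` conclusion shape (first two conjuncts).
[cite: Balaban1987RG1, Thm 2 p.259 (first sentence) with (0.20) p.256 and p.298] -/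
theorem not_endpointAt_of_gap
    (hcpl : ∀ (P : B12.RunParams) (k : ℕ), S.cpl P k = Nat.rec (motive := fun _ => ℝ) P.g0
      (fun k g => 1 / Real.sqrt (1 / g ^ 2 - (b + (if k = 1 then J P.g0 else 0) * g))) k)
    (hgap : ∀ z₀ : ℝ, ∃ z : ℝ, z₀ ≤ z ∧ ∀ x : ℝ, 0 < x → b < 1 / x ^ 2 →
      1 / x ^ 2 - J x * (1 / Real.sqrt (1 / x ^ 2 - b)) ≠ z)
    (m : ℕ) {γ : ℝ} (hγ : 0 < γ) {gmax : ℝ} (hgmax : 0 < gmax) :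
    ∃ g : ℝ, 0 < g ∧ g ≤ γ ∧ g ≤ gmax ∧ ∃ K : ℕ,
      ∀ g₀ : ℝ, ¬ (Step.InInterval γ K (S.cpl ⟨K, m, g₀⟩) ∧ S.cpl ⟨K, m, g₀⟩ K = g) := by
  obtain ⟨z, hz, hzgap⟩ := hgap (1 / γ ^ 2 + 1 / gmax ^ 2 + 2 * b)
  have hγsq : 0 < 1 / γ ^ 2 := one_div_pos.mpr (pow_pos hγ 2)
  have hgmsq : 0 < 1 / gmax ^ 2 := one_div_pos.mpr (pow_pos hgmax 2)
  have hzb : 0 < z - 2 * b := by linarith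
  set g : ℝ := 1 / Real.sqrt (z - 2 * b) with hgdef
  have hgpos : 0 < g := by positivity
  have hgsq : 1 / g ^ 2 = z - 2 * b := by
    rw [hgdef, div_pow, one_pow, Real.sq_sqrt hzb.le, one_div_one_div]
  have hle_of : ∀ {c : ℝ}, 0 < c → 1 / c ^ 2 ≤ 1 / g ^ 2 → g ≤ c := by
    intro c hc h1
    have h2 : g ^ 2 ≤ c ^ 2 := (one_div_le_one_div (pow_pos hc 2) (pow_pos hgpos 2)).mp h1
    nlinarith
  have hgle : g ≤ γ := hle_of hγ (by rw [hgsq]; linarith)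
  have hglemax : g ≤ gmax := hle_of hgmax (by rw [hgsq]; linarith)
  refine ⟨g, hgpos, hgle, hglemax, 2, fun g₀ h => ?_⟩
  obtain ⟨hI, hend⟩ := h
  have h0 := (hI 0 (by norm_num)).1
  have h1 := (hI 1 (by norm_num)).1
  have h2 := (hI 2 le_rfl).1
  rw [run_zero hcpl] at h0
  obtain ⟨hbg, hc1, hread⟩ := readout_two hcpl ⟨2, m, g₀⟩ h1 h2
  rw [hend, hgsq, hc1] at hread
  dsimp only at h0 hbg hread
  exact hzgap g₀ h0 hbg (by linarith)

/-- **THE `EndpointExistence` QUANTIFIER SHAPE FAILS** (∃ γ₂ ∀ γ ≤ γ₂ ∃ g⋆ ∀ g ≤ g⋆ ∀ K ∃ g₀: run in ]0, γ], g_K = g — the shape of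
`DagBinding.EndpointExistence` and of prover 2's `endpoint_of_partialSums`, read on the carrier's coupling table): same toy, same gap (at γ = γ₂,
below g⋆). [cite: Balaban1987RG1, Thm 2 p.259 (first sentence) with (0.20) p.256 and p.298] -/
theorem not_endpointShape_of_gap
    (hcpl : ∀ (P : B12.RunParams) (k : ℕ), S.cpl P k = Nat.rec (motive := fun _ => ℝ) P.g0
      (fun k g => 1 / Real.sqrt (1 / g ^ 2 - (b + (if k = 1 then J P.g0 else 0) * g))) k)
    (hgap : ∀ z₀ : ℝ, ∃ z : ℝ, z₀ ≤ z ∧ ∀ x : ℝ, 0 < x → b < 1 / x ^ 2 →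
      1 / x ^ 2 - J x * (1 / Real.sqrt (1 / x ^ 2 - b)) ≠ z) (m : ℕ) :
    ¬ ∃ γ₂ : ℝ, 0 < γ₂ ∧ ∀ γ : ℝ, 0 < γ → γ ≤ γ₂ → ∃ gstar : ℝ, 0 < gstar ∧ ∀ g : ℝ, 0 < g → g ≤ gstar →
      ∀ K : ℕ, ∃ g₀ : ℝ, Step.InInterval γ K (S.cpl ⟨K, m, g₀⟩) ∧ S.cpl ⟨K, m, g₀⟩ K = g := by
  rintro ⟨γ₂, hγ₂, hγ⟩
  obtain ⟨gstar, hgstar, hg⟩ := hγ γ₂ hγ₂ le_rfl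
  obtain ⟨g, hgpos, -, hgle, K, hK⟩ := not_endpointAt_of_gap hcpl hgap m hγ₂ hgstar
  obtain ⟨g₀, hI, hend⟩ := hg g hgpos hgle K
  exact hK g₀ ⟨hI, hend⟩

/-- **[I] AS PRINTED + THE SIGN, UPPER AND LAST-VARIABLE LETTERS DO NOT GIVE THE FIRST SENTENCE OF THEOREM 2.**  There is a setting with
`StandingHypotheses ∧ Definitions ∧ Conclusions`, the p. 266 flag ON, the SIGN letter `BetaLowerH 0 1 S.β`, the upper letter `BetaUpperH (1∕100 + 1) 1 S.β`,
`BetaSmoothInLast264 1 S.β` and row I1's `LastVarLipschitz S.β 1 1`, for which BOTH first-sentence shapes FAIL: for every γ > 0 and every bound some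
g ≤ min(γ, bound) and K admit no bare coupling, and the `EndpointExistence` shape is false. [cite: Balaban1987RG1, Thm 2 p.259 (first sentence) with p.264 and p.298] -/
theorem asPrinted_sign_not_firstSentence :
    ∃ S : Setting, ∃ _hH : StandingHypotheses S, Definitions S ∧ Conclusions S ∧ S.altCutoff266 ∧
      BetaLowerH 0 1 S.β ∧ BetaUpperH (1 / 100 + 1 ^ 3) 1 S.β ∧ BetaSmoothInLast264 1 S.β ∧ LastVarLipschitz S.β (1 ^ 2) 1 ∧
      (∀ (m : ℕ) (γ : ℝ), 0 < γ → ∀ gmax : ℝ, 0 < gmax → ∃ g : ℝ, 0 < g ∧ g ≤ γ ∧ g ≤ gmax ∧ ∃ K : ℕ,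
        ∀ g₀ : ℝ, ¬ (Step.InInterval γ K (S.cpl ⟨K, m, g₀⟩) ∧ S.cpl ⟨K, m, g₀⟩ K = g)) ∧
      (∀ m : ℕ, ¬ ∃ γ₂ : ℝ, 0 < γ₂ ∧ ∀ γ : ℝ, 0 < γ → γ ≤ γ₂ → ∃ gstar : ℝ, 0 < gstar ∧ ∀ g : ℝ, 0 < g → g ≤ gstar →
        ∀ K : ℕ, ∃ g₀ : ℝ, Step.InInterval γ K (S.cpl ⟨K, m, g₀⟩) ∧ S.cpl ⟨K, m, g₀⟩ K = g) := by
  obtain ⟨S, hβ, hcpl, hγ, halt, hH, hD, hC⟩ := histJumpToy_exists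
  have hgap := readout_gap_unbounded (b := (1 / 100 : ℝ)) (by norm_num) (by norm_num)
  have hlo : BetaLowerH (1 / 100) 1 S.β := betaLowerH_of_histJump hβ jump_nonneg jump_le_sq 1
  refine ⟨S, hH, hD, hC, halt, fun k v hv => le_trans (by norm_num) (hlo k v hv),
    betaUpperH_of_histJump hβ jump_nonneg jump_le_sq one_pos, betaSmoothInLast264_of_histJump hβ 1,
    lastVarLipschitz_of_histJump hβ jump_nonneg jump_le_sq 1,
    fun m γ hγ' gmax hgmax => not_endpointAt_of_gap hcpl hgap m hγ' hgmax, fun m => not_endpointShape_of_gap hcpl hgap m⟩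

/-- **(C) IS LOAD-BEARING FOR THE FIRST SENTENCE.**  Prover 2's `…LowerEnd.endpoint_of_sign` with its binder `hcont` DROPPED (sign + upper letter
+ `Definitions` ⟹ for every γ ≤ γ₀, g ≤ γ, K a bare coupling with the run in ]0, γ] and g_K = g) is FALSE, and so is the `EndpointExistence`-shaped
`endpoint_of_partialSums` with `hcont` dropped (partial sums ≥ −M from the sign with M = 0, `FlowStepRuns.betaPartialSumsLowerH_of_sign`) — even with
`StandingHypotheses ∧ Conclusions` added.  Witness: §16's toy at γ₀ = 1, β′ = 1∕100 + 1. [cite: Balaban1987RG1, Thm 2 p.259 (first sentence) with p.298] -/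
theorem histCont_loadBearing_firstSentence :
    (¬ ∀ (S : Setting) (_hH : StandingHypotheses S), Definitions S → Conclusions S → ∀ γ₀ β' : ℝ, 0 ≤ β' → 0 < γ₀ →
        BetaLowerH 0 γ₀ S.β → BetaUpperH β' γ₀ S.β → ∀ (m : ℕ) (γ : ℝ), 0 < γ → γ ≤ γ₀ → ∀ g : ℝ, 0 < g → g ≤ γ → ∀ K : ℕ,
          ∃ g₀ : ℝ, Step.InInterval γ K (S.cpl ⟨K, m, g₀⟩) ∧ S.cpl ⟨K, m, g₀⟩ K = g) ∧
    (¬ ∀ (S : Setting) (_hH : StandingHypotheses S), Definitions S → Conclusions S → ∀ γ₀ M β' : ℝ, 0 ≤ M → 0 ≤ β' → 0 < γ₀ →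
        BetaPartialSumsLowerH M γ₀ S.β → BetaUpperH β' γ₀ S.β → ∀ m : ℕ,
          ∃ γ₂ : ℝ, 0 < γ₂ ∧ ∀ γ : ℝ, 0 < γ → γ ≤ γ₂ → ∃ gstar : ℝ, 0 < gstar ∧ ∀ g : ℝ, 0 < g → g ≤ gstar →
            ∀ K : ℕ, ∃ g₀ : ℝ, Step.InInterval γ K (S.cpl ⟨K, m, g₀⟩) ∧ S.cpl ⟨K, m, g₀⟩ K = g) := by
  obtain ⟨S, hH, hD, hC, -, hsign, hup, -, -, hno, hnoShape⟩ := asPrinted_sign_not_firstSentence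
  refine ⟨fun h => ?_, fun h => ?_⟩
  · obtain ⟨g, hgpos, hgle, -, K, hK⟩ := hno 0 1 one_pos 1 one_pos
    obtain ⟨g₀, hg₀⟩ := h S hH hD hC 1 (1 / 100 + 1 ^ 3) (by norm_num) one_pos hsign hup 0 1 one_pos le_rfl g hgpos hgle K
    exact hK g₀ hg₀
  · exact hnoShape 0 (h S hH hD hC 1 0 (1 / 100 + 1 ^ 3) le_rfl (by norm_num) one_pos (betaPartialSumsLowerH_of_sign hsign) hup 0)

end

end Summit.QuantumFields.BalabanUV.Beta.EriceFlowEnclosureB12AsPrintedHistoryJumpFirstSentence
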